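import Literature.NumberTheory.Automorphic.UnitaryGroupTorusMeasureCoherence
import Literature.NumberTheory.Automorphic.CompactCoreLevel
import HarnessLib

/-!
# The `hK` input of the torus-measure coherence theorem from F4-a `CompactCoreCentralizerLevelAE`
(Rogawski (1990) §4.3 p. 43: at the unramified places `T(𝒪_v) = T(L⁺_v) ∩ K_v` is the maximal compact subgroup, `vol T(𝒪_v) = 1`)

Topic `NumberTheory/Automorphic`; THEOREMS ONLY.  ★ `UnitaryGroup.CompactCoreCentralizerLevelAE L N H` (the compact core of `Z(γ_v)` lies in the
level `K_v` for almost all `v`; a THEOREM at hermitian non-degenerate `H`, ★ `compactCoreCentralizerLevelAE_of_hermitian`) READ ON THE MODEL `localPi v`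
along ★ `localPiEquiv`: for almost all `v`, the integral subgroup `Z((g_f)_v) ∩ localInt v` of the model-local torus IS its compact core — the
hypothesis `hK` of ★ `UnitaryGroup.map_adelicStableCentralizerEquiv_torusMeasure_eq`.

## References
* J. D. Rogawski, *Automorphic Representations of Unitary Groups in Three Variables* (1990), §4.3 p. 43 [Rogawski1990].
* V. Platonov, A. Rapinchuk, *Algebraic Groups and Number Theory* (1994), §6 [PlatonovRapinchuk1994].
-/

set_option autoImplicit false

noncomputable section

open _root_.MeasureTheory Set Filter Function NumberField IsDedekindDomain
open _root_.Topology
open Literature.Topology.Algebra.RestrictedProduct Literature.MeasureTheory.Group Literature.NumberTheory.Rogawski1990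
open scoped RestrictedProduct Matrix MatrixGroups

namespace Literature.NumberTheory.Automorphic

namespace UnitaryGroup

variable (L : Type) [Field L] [NumberField L] [IsCMField L] (N : ℕ) (H : Matrix (Fin N) (Fin N) L)

/-- **`hK` from F4-a**: if the compact core of `Z(γ_v) ≤ U(H)(L⁺_v)` lies in the level `K_v` for almost all `v` (★ `CompactCoreCentralizerLevelAE`),
then for almost all `v` the integral subgroup `Z((g_f)_v) ∩ localInt v` of the MODEL-local torus (`g = γ ⊗ 1` read on `localPi v`) IS the compact
core: `localPiEquiv` identifies the two tori (★ `cmDatum_toLocal_eq_localPiEquiv`) and the two levels (★ `localPiEquiv_mem_localIntegralLevel_iff`),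
isomorphisms respect compact cores (★ `image_compactCore`), and a compact subgroup containing the compact core IS it (★ `compactCore_eq_of_subset`).
[cite: Rogawski1990, §4.3 p. 43] [cite: PlatonovRapinchuk1994, §6] -/
theorem eventually_inH_localInt_eq_compactCore (hF : CompactCoreCentralizerLevelAE L N H) (γ : (cmDatum L N H).Rational)
    (hreg : IsRegularElt (γ.val : GL (Fin N) L)) [hKc : ∀ v, CompactSpace (localInt L (IsCMField.complexConj L) N H v)]
    [hCP : ∀ v, IsClosed (((Subgroup.centralizer ({((finAdelicEquiv (↥(maximalRealSubfield L)) L (IsCMField.complexConj L) N H) (finPart (↥(maximalRealSubfield L)) L (IsCMField.complexConj L) N H ((cmDatum L N H).toAdelic γ))) v} : Set ↥(localPi L (IsCMField.complexConj L) N H v))) : Subgroup ↥(localPi L (IsCMField.complexConj L) N H v)) : Set ↥(localPi L (IsCMField.complexConj L) N H v))] :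
    ∀ᶠ v in cofinite, ((inH (fun v => localInt L (IsCMField.complexConj L) N H v) (fun v => Subgroup.centralizer ({((finAdelicEquiv (↥(maximalRealSubfield L)) L (IsCMField.complexConj L) N H) (finPart (↥(maximalRealSubfield L)) L (IsCMField.complexConj L) N H ((cmDatum L N H).toAdelic γ))) v} : Set ↥(localPi L (IsCMField.complexConj L) N H v))) v : Subgroup (Subgroup.centralizer ({((finAdelicEquiv (↥(maximalRealSubfield L)) L (IsCMField.complexConj L) N H) (finPart (↥(maximalRealSubfield L)) L (IsCMField.complexConj L) N H ((cmDatum L N H).toAdelic γ))) v} : Set ↥(localPi L (IsCMField.complexConj L) N H v)))) : Set (Subgroup.centralizer ({((finAdelicEquiv (↥(maximalRealSubfield L)) L (IsCMField.complexConj L) N H) (finPart (↥(maximalRealSubfield L)) L (IsCMField.complexConj L) N H ((cmDatum L N H).toAdelic γ))) v} : Set ↥(localPi L (IsCMField.complexConj L) N H v)))) = compactCore (Subgroup.centralizer ({((finAdelicEquiv (↥(maximalRealSubfield L)) L (IsCMField.complexConj L) N H) (finPart (↥(maximalRealSubfield L)) L (IsCMField.complexConj L) N H ((cmDatum L N H).toAdelic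 γ))) v} : Set ↥(localPi L (IsCMField.complexConj L) N H v))) := by
  filter_upwards [hF γ hreg] with v hv
  -- the model-local torus is the datum torus along `ψ_v = localPiEquiv`
  have hγv : (cmDatum L N H).toLocal v ((cmDatum L N H).toAdelic γ) = (localPiEquiv L (IsCMField.complexConj L) N H v) (((finAdelicEquiv (↥(maximalRealSubfield L)) L (IsCMField.complexConj L) N H) (finPart (↥(maximalRealSubfield L)) L (IsCMField.complexConj L) N H ((cmDatum L N H).toAdelic γ))) v) := cmDatum_toLocal_eq_localPiEquiv L H v ((cmDatum L N H).toAdelic γ)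
  obtain ⟨Q, hQ⟩ := exists_continuousMulEquiv_subgroup_apply_eq (localPiEquiv L (IsCMField.complexConj L) N H v) (Subgroup.centralizer ({((finAdelicEquiv (↥(maximalRealSubfield L)) L (IsCMField.complexConj L) N H) (finPart (↥(maximalRealSubfield L)) L (IsCMField.complexConj L) N H ((cmDatum L N H).toAdelic γ))) v} : Set ↥(localPi L (IsCMField.complexConj L) N H v))) (Subgroup.centralizer ({(cmDatum L N H).toLocal v ((cmDatum L N H).toAdelic γ)} : Set ((cmDatum L N H).Local v)))
    (forall_apply_mem_centralizer_singleton_iff_of_eq (localPiEquiv L (IsCMField.complexConj L) N H v).toMulEquiv hγv.symm)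
  symm
  refine compactCore_eq_of_subset _ ?_ fun z hz => ?_
  · exact (hCP v).isClosedEmbedding_subtypeVal.isCompact_preimage (isCompact_iff_compactSpace.2 (hKc v))
  · -- `Q z` lies in the compact core of `Z(γ_v)`, hence in `K_v`; read back on the model
    have h1 : Q z ∈ compactCore (Subgroup.centralizer ({(cmDatum L N H).toLocal v ((cmDatum L N H).toAdelic γ)} : Set ((cmDatum L N H).Local v))) := (apply_mem_compactCore_iff Q z).2 hz
    have h2 := hv h1
    rw [mem_preimage, hQ] at h2
    rw [SetLike.mem_coe, Subgroup.mem_subgroupOf]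
    exact (localPiEquiv_mem_localIntegralLevel_iff (IsCMField.complexConj L) N H v _).1 h2

end UnitaryGroup

end Literature.NumberTheory.Automorphic
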